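import Literature.NumberTheory.Sieve.QuadraticRootsTwistedHooley
import Literature.NumberTheory.Sieve.QuadraticRootsTothReduction
import Summits.Parity.BatemanHorn.Theorems.RoughValueTransportDefs
import HarnessLib

/-!
# Route `RoughValueTransport`, crux `BalancedSemiprimeLayer` (stmt-Parity-9469), line
# `smooth-modulus-twisted-hooley`: the registered stub `stub_twistedHooley` (THE LEVER) — PROVED

`TwistedHooleyDilates (disc g)` for every irreducible quadratic `g ∈ ℤ[X]`: a Hooley-1963-type power
saving (`η = 1/8`, losses `Q^5 |h|^5`) for the root Weyl sums of the dilates `Q²X² − Δ` over the moduli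
`m ≤ M` of a class `m ≡ u (mod Q)`, `(m, Q) = 1`.  The analytic theorem is PROVED in
`Literature/NumberTheory/Sieve/QuadraticRootsTwistedHooley.lean`
(`Literature.NumberTheory.Sieve.TwistedHooley.norm_sum_twistedDilates_le`, "route B" of the lead's
blueprint `Cruxes/BalancedSemiprimeLayer/NOTES.md`: the discriminant is kept at `4Δ`, `Q` is carried in
the phase); here it is combined with "an irreducible quadratic has non-square discriminant"
(`RootForms.not_isSquare_discrim_of_irreducible`).
-/

namespace Summit.Parity.BatemanHorn.Cruxes.BalancedSemiprimeLayer.SmoothModulusTwistedHooley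

open Polynomial Finset
open Literature.NumberTheory.Sieve

/-- `TwistedHooleyDilates D` for every non-square `D` (`η = 1/8`, `A = 5`, `K = K(D)` from
`TwistedHooley.norm_sum_twistedDilates_le`). [folklore] -/
theorem twistedHooleyDilates_of_not_isSquare {D : ℤ} (hD : ¬ IsSquare D) : TwistedHooleyDilates D := by
  obtain ⟨K, hK⟩ := TwistedHooley.norm_sum_twistedDilates_le hD
  exact ⟨1 / 8, by norm_num, 5, K, fun Q u h M hQ hh hM => hK Q u h M hQ hh hM⟩

/-- **stub_twistedHooley** (THE LEVER of line `smooth-modulus-twisted-hooley`, PROVED): for every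
irreducible quadratic `g ∈ ℤ[X]` the twisted Hooley bound `TwistedHooleyDilates (disc g)` holds.
Proof: an irreducible quadratic has non-square discriminant (`RootForms.not_isSquare_discrim_of_irreducible`)
and `twistedHooleyDilates_of_not_isSquare`. [folklore] -/
theorem stub_twistedHooley :
    ∀ g : ℤ[X], g.natDegree = 2 → Irreducible g →
      TwistedHooleyDilates (discrim (g.coeff 2) (g.coeff 1) (g.coeff 0)) :=
  fun _ hg hirr => twistedHooleyDilates_of_not_isSquare
    (RootForms.not_isSquare_discrim_of_irreducible hg hirr)

end Summit.Parity.BatemanHorn.Cruxes.BalancedSemiprimeLayer.SmoothModulusTwistedHooley
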